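import Literature.NumberTheory.LFunctions.ExceptionalZeroPsi
import Literature.NumberTheory.LFunctions.ExceptionalZeroSimple
import Literature.NumberTheory.LFunctions.SiegelWalfisz
import HarnessLib

/-!
# The hypotheses of Landau's method with an exceptional zero for `Λ_{q,a}`
# (Montgomery–Vaughan Theorem 11.16, Case 2, and (11.22))

Topic `Literature/NumberTheory/LFunctions`. Everything in this file is PROVED (theorems, and the
definition of the concrete function `F`).

Let `χ` be a real non-principal character mod `q` with a real zero `β > 1 − c/log 4q` of
`L(s, χ)` (an exceptional zero). For `(a, q) = 1` the non-negative sequence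
`Λ_{q,a}(n) = φ(q)Λ(n)𝟙_{n ≡ a (q)}` has Dirichlet series (MV (11.22))
`∑_{χ'} χ̄'(a)(−L'/L(s, χ')) = 1/(s − 1) − χ(a)/(s − β) + F(s)` with

  `F = −L₁'/L₁(s, χ₀) − ∑_{χ' ≠ χ₀, χ} χ̄'(a) L'/L(s, χ') − χ(a) g'/g(s)`,
  `g(s) = L(s, χ)/(s − β)`  (`= L'(β, χ)` at `s = β`; Mathlib's `dslope`),

and we verify `Literature.NumberTheory.LFunctions.ExcPsiData Λ_{q,a} F c (Kq⁵) (log q) β χ(a)`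
(`ExceptionalZeroPsi.lean`) with ABSOLUTE `c, K`: `F` is holomorphic on
`σ > 1 − c/(log q + log(|t| + 4))` — this region contains no zero of any `L(s, χ')`, `χ'` mod
`q`, other than `β` itself (MV Theorem 11.3 for the complex zeros,
`Literature.NumberTheory.LFunctions.DirichletZFR.exists_zeroFree`; Landau–Page for the real ones:
`exists_min_realZeros_le` for `χ`, `exists_landau_sameLevel_min_le` for `χ' ≠ χ`; and `β` is a
SIMPLE zero, `Literature.NumberTheory.LFunctions.DirichletZFR.exists_deriv_ne_zero_of_realZero`,
so `g(β) ≠ 0`) — and off `β`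
`|F(s)| ≤ K q⁵ log⁵(|t|+4)(1 + 1/|s − β|)` from MV Theorem 11.4
(`Literature.NumberTheory.LFunctions.DirichletZFR.exists_norm_logDeriv_le_of_re_ge`, applied with
the distance `d = min(|s − β|, c'/log 4q, 1)` to the exceptional zeros) and MV Theorem 6.7 for `ζ`.

## Main results

* `PagePNT.excF` — the function `F` above;
* `PagePNT.LSeries_residueClass_eq_excF` — MV (11.22) with the two poles split off;
* `PagePNT.exists_excPsiData` — the hypotheses `ExcPsiData`, uniformly in `q`.

## References

* H. L. Montgomery, R. C. Vaughan, *Multiplicative Number Theory I. Classical Theory*, CUP 2007,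
  §11.3: (11.22), Theorem 11.16 (proof, Case 2), Corollary 11.17; §11.1 Theorems 11.3–11.4;
  §11.2 Corollary 11.8 (`MontgomeryVaughan2007`).
-/

noncomputable section

open Complex Filter Topology Metric Set Finset
open scoped LSeries.notation ArithmeticFunction.vonMangoldt

namespace Literature.NumberTheory.LFunctions.PagePNT

open Literature.NumberTheory.LFunctions.DirichletZFR

/-! ## The quotient `g(s) = L(s, χ)/(s − β)` -/

section Dslope

variable {q : ℕ} [NeZero q] (χ : DirichletCharacter ℂ q)

/-- For `χ ≠ χ₀`, `g = dslope L(·, χ) b` (`= (L(s,χ) − L(b,χ))/(s − b)` off `b`, `= L'(b, χ)` at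
`b`) is entire (`L(·, χ)` is entire). [folklore] -/
theorem differentiable_dslope_LFunction (hχ : χ ≠ 1) (b : ℂ) :
    Differentiable ℂ (dslope χ.LFunction b) := by
  intro z
  have hL := DirichletCharacter.differentiable_LFunction hχ
  rcases eq_or_ne z b with rfl | hz
  · obtain ⟨p, hp⟩ := hL.analyticAt z
    exact (hp.has_fpower_series_dslope_fslope.analyticAt).differentiableAt
  · exact (differentiableAt_dslope_of_ne hz).2 (hL z)

/-- `L(s, χ) = (s − β) g(s)` when `L(β, χ) = 0`. [folklore] -/
theorem LFunction_eq_mul_dslope {b : ℂ} (hb : χ.LFunction b = 0) (s : ℂ) :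
    χ.LFunction s = (s - b) * dslope χ.LFunction b s := by
  have := sub_smul_dslope χ.LFunction b s
  rw [hb, sub_zero, smul_eq_mul] at this
  exact this.symm

/-- `L'/L(s, χ) = 1/(s − β) + g'/g(s)` off the zeros of `L(·, χ)` (so `s ≠ β`, `g(s) ≠ 0`),
for `χ ≠ χ₀` with `L(β, χ) = 0`. [folklore] -/
theorem logDeriv_LFunction_eq_add (hχ : χ ≠ 1) {b : ℂ} (hb : χ.LFunction b = 0) {s : ℂ}
    (hs : χ.LFunction s ≠ 0) :
    deriv χ.LFunction s / χ.LFunction s =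
      1 / (s - b) + deriv (dslope χ.LFunction b) s / dslope χ.LFunction b s := by
  set g := dslope χ.LFunction b with hg
  have hfun : χ.LFunction = fun s ↦ (s - b) * g s := funext (LFunction_eq_mul_dslope χ hb)
  have hgd := differentiable_dslope_LFunction χ hχ b
  have hsb : s - b ≠ 0 := by
    intro h; rw [LFunction_eq_mul_dslope χ hb s, h, zero_mul] at hs; exact hs rfl
  have hgs : g s ≠ 0 := by
    intro h; rw [LFunction_eq_mul_dslope χ hb s, ← hg, h, mul_zero] at hs; exact hs rfl
  have hder : deriv χ.LFunction s = 1 * g s + (s - b) * deriv g s := by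
    rw [hfun]
    exact (((hasDerivAt_id s).sub_const b).mul (hgd s).hasDerivAt).deriv
  rw [hder, LFunction_eq_mul_dslope χ hb s, ← hg]
  field_simp

/-- `‖g'/g(s)‖ ≤ ‖L'/L(s, χ)‖ + 1/‖s − β‖` off the zeros. [folklore] -/
theorem norm_logDeriv_dslope_le (hχ : χ ≠ 1) {b : ℂ} (hb : χ.LFunction b = 0) {s : ℂ}
    (hs : χ.LFunction s ≠ 0) :
    ‖deriv (dslope χ.LFunction b) s / dslope χ.LFunction b s‖ ≤
      ‖deriv χ.LFunction s / χ.LFunction s‖ + ‖s - b‖⁻¹ := by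
  have h := logDeriv_LFunction_eq_add χ hχ hb hs
  have : deriv (dslope χ.LFunction b) s / dslope χ.LFunction b s =
      deriv χ.LFunction s / χ.LFunction s - 1 / (s - b) := by rw [h]; ring
  rw [this]
  refine (norm_sub_le _ _).trans (le_of_eq ?_)
  rw [one_div, norm_inv]

/-- `g(s) ≠ 0` off the zeros of `L(·, χ)`. [folklore] -/
theorem dslope_ne_zero_of_ne {b s : ℂ} (hb : χ.LFunction b = 0) (hs : χ.LFunction s ≠ 0) :
    dslope χ.LFunction b s ≠ 0 := by
  intro h; rw [LFunction_eq_mul_dslope χ hb s, h, mul_zero] at hs; exact hs rfl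

end Dslope

/-! ## Values of a quadratic character at a unit -/

/-- For a quadratic character `χ` and a unit `a`: `χ(a⁻¹) = χ(a) ∈ {1, −1}`. [folklore] -/
theorem quadratic_apply_inv {q : ℕ} [NeZero q] {χ : DirichletCharacter ℂ q} (hχ : χ.IsQuadratic)
    {a : ZMod q} (ha : IsUnit a) : χ a⁻¹ = χ a ∧ (χ a = 1 ∨ χ a = -1) := by
  have h1 : χ a * χ a⁻¹ = 1 := by rw [← map_mul, ZMod.mul_inv_of_unit a ha, map_one]
  rcases hχ a with h | h | h
  · rw [h, zero_mul] at h1; exact absurd h1 zero_ne_one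
  · rw [h, one_mul] at h1; exact ⟨h1.trans h.symm, Or.inl h⟩
  · rw [h] at h1
    have : χ a⁻¹ = -1 := by linear_combination -h1
    exact ⟨this.trans h.symm, Or.inr h⟩

/-- For a quadratic character `χ` and a unit `a`: `χ(a⁻¹)` is the real number `Re χ(a)`, of
absolute value `≤ 1`. [folklore] -/
theorem quadratic_apply_inv_eq_re {q : ℕ} [NeZero q] {χ : DirichletCharacter ℂ q}
    (hχ : χ.IsQuadratic) {a : ZMod q} (ha : IsUnit a) :
    χ a⁻¹ = (((χ a).re : ℝ) : ℂ) ∧ |(χ a).re| ≤ 1 := by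
  obtain ⟨hinv, h | h⟩ := quadratic_apply_inv hχ ha
  · rw [hinv, h]; simp
  · rw [hinv, h]; simp

/-! ## The function `F` and the Dirichlet series of `Λ_{q,a}` -/

/-- **The holomorphic part `F` of `∑ Λ_{q,a}(n) n^{-s}`** (MV (11.22) with both poles removed):
`F(s) = −L₁'/L₁(s, χ₀) − ∑_{χ' ≠ χ₀, χ} χ'(a⁻¹) L'/L(s, χ') − χ(a⁻¹) g'/g(s)`,
`g = dslope L(·, χ) β` (`L₁ = (s−1)L(s,χ₀)` is Mathlib's `LFunctionTrivChar₁`).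
[cite: MontgomeryVaughan2007, §11.3 eq. (11.22) and Theorem 11.16] -/
def excF (q : ℕ) [NeZero q] (a : ZMod q) (χ : DirichletCharacter ℂ q) (β : ℝ) (s : ℂ) : ℂ :=
  -(deriv (DirichletCharacter.LFunctionTrivChar₁ q) s / DirichletCharacter.LFunctionTrivChar₁ q s) -
    (∑ χ' ∈ (({1}ᶜ : Finset (DirichletCharacter ℂ q)).erase χ),
      χ' a⁻¹ * (deriv χ'.LFunction s / χ'.LFunction s)) -
    χ a⁻¹ * (deriv (dslope χ.LFunction (β : ℂ)) s / dslope χ.LFunction (β : ℂ) s)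

/-- **MV (11.22) with the poles split off**: for `χ ≠ χ₀` with `L(β, χ) = 0`, `(a, q) = 1` and
`σ > 1`,
`∑ Λ_{q,a}(n) n^{-s} = 1/(s − 1) − χ(a⁻¹)/(s − β) + F(s)` (`Λ_{q,a} = φ(q)Λ𝟙_{≡ a}`; Mathlib's
`LFunctionResidueClassAux` gives `∑_{χ'} χ'(a⁻¹)(−L'/L(s,χ')) = 1/(s−1) + φ(q)·Aux(s)`, and
`L'/L(s,χ) = 1/(s−β) + g'/g(s)`). [cite: MontgomeryVaughan2007, §11.3 eq. (11.22)] -/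
theorem LSeries_residueClass_eq_excF {q : ℕ} [NeZero q] {χ : DirichletCharacter ℂ q} (hχ : χ ≠ 1)
    {β : ℝ} (hβ : χ.LFunction β = 0) {a : ZMod q} (ha : IsUnit a) {s : ℂ} (hs : 1 < s.re) :
    LSeries (fun n ↦ (((q.totient : ℝ) * ArithmeticFunction.vonMangoldt.residueClass a n : ℝ) : ℂ))
        s = 1 / (s - 1) - χ a⁻¹ / (s - (β : ℂ)) + excF q a χ β s := by
  classical
  have hφ : (q.totient : ℂ) ≠ 0 := by exact_mod_cast (Nat.totient_pos.2 (NeZero.pos q)).ne'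
  have hAux := ArithmeticFunction.vonMangoldt.eqOn_LFunctionResidueClassAux ha hs
  have hsm : LSeries (fun n ↦ (((q.totient : ℝ) *
      ArithmeticFunction.vonMangoldt.residueClass a n : ℝ) : ℂ)) s =
      (q.totient : ℂ) * LSeries (↗(ArithmeticFunction.vonMangoldt.residueClass a)) s := by
    rw [← LSeries_smul]
    refine LSeries_congr (fun {n} _ ↦ ?_) s
    simp only [Pi.smul_apply, smul_eq_mul]
    push_cast
    ring
  -- `φ · Aux = −L₁'/L₁ − ∑_{χ' ≠ 1} χ'(a⁻¹) L'/L`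
  have hAux2 : (q.totient : ℂ) * ArithmeticFunction.vonMangoldt.LFunctionResidueClassAux a s =
      -(deriv (DirichletCharacter.LFunctionTrivChar₁ q) s /
          DirichletCharacter.LFunctionTrivChar₁ q s) -
        ∑ χ' ∈ ({1}ᶜ : Finset (DirichletCharacter ℂ q)),
          χ' a⁻¹ * (deriv χ'.LFunction s / χ'.LFunction s) := by
    simp only [ArithmeticFunction.vonMangoldt.LFunctionResidueClassAux, ← mul_assoc,
      mul_inv_cancel₀ hφ, one_mul]
    simp only [mul_div_assoc, neg_div]
    congr 1
    exact Finset.sum_congr (by ext; simp) (fun _ _ ↦ rfl)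
  -- split off `χ` from the sum and use `L'/L(s, χ) = 1/(s − β) + g'/g(s)`
  have hχmem : χ ∈ ({1}ᶜ : Finset (DirichletCharacter ℂ q)) := by simpa using hχ
  have hsum : ∑ χ' ∈ ({1}ᶜ : Finset (DirichletCharacter ℂ q)),
      χ' a⁻¹ * (deriv χ'.LFunction s / χ'.LFunction s) =
      (∑ χ' ∈ (({1}ᶜ : Finset (DirichletCharacter ℂ q)).erase χ),
        χ' a⁻¹ * (deriv χ'.LFunction s / χ'.LFunction s)) +
      χ a⁻¹ * (deriv χ.LFunction s / χ.LFunction s) :=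
    (Finset.sum_erase_add _ _ hχmem).symm
  have hLs : χ.LFunction s ≠ 0 :=
    DirichletCharacter.LFunction_ne_zero_of_one_le_re χ (Or.inl hχ) hs.le
  have hld := logDeriv_LFunction_eq_add χ hχ hβ hLs
  -- assemble
  have hLS : LSeries (↗(ArithmeticFunction.vonMangoldt.residueClass a)) s =
      ArithmeticFunction.vonMangoldt.LFunctionResidueClassAux a s + (q.totient : ℂ)⁻¹ / (s - 1) := by
    have := hAux
    simp only at this
    rw [this]; ring
  rw [hsm, hLS, mul_add, hAux2, hsum, hld, excF]
  field_simp
  ring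

/-! ## The region `σ > 1 − c/(log q + log(|t| + 4))` and distances to the other zeros -/

/-- `(min a b)⁻¹ ≤ a⁻¹ + b⁻¹` for `a, b > 0`. [folklore] -/
theorem inv_min_le {a b : ℝ} (ha : 0 < a) (hb : 0 < b) : (min a b)⁻¹ ≤ a⁻¹ + b⁻¹ := by
  rcases min_choice a b with h | h <;> rw [h]
  · have := inv_pos.2 hb; linarith
  · have := inv_pos.2 ha; linarith

/-- Elementary facts on the region with `c ≤ min(c₃, c_ζ, 1/4)`: `σ > 3/4`, `σ` is in the classical
region of `ζ`, in the region `σ ≥ 1 − c₃/(log q + log(|t|+4))` of MV Theorem 11.4, and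
`σ > 1 − c/(log q + log 4)`. [folklore] -/
theorem region_facts {q : ℕ} {c c₃ cζ : ℝ} (hc : 0 < c) (hc₃ : c ≤ c₃) (hcζ : c ≤ cζ)
    (hc4 : c ≤ 1 / 4) {s : ℂ} (hs : 1 - c / (Real.log q + Real.log (|s.im| + 4)) < s.re) :
    3 / 4 < s.re ∧ 1 - cζ / Real.log (|s.im| + 4) ≤ s.re ∧
      1 - c₃ / (Real.log q + Real.log (|s.im| + 4)) ≤ s.re ∧
      1 - c / (Real.log q + Real.log 4) < s.re := by
  have hlogq : 0 ≤ Real.log q := Real.log_natCast_nonneg q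
  have hlogτ : 1 ≤ Real.log (|s.im| + 4) := ClassicalZFRData.one_le_log_tau s.im
  have hlog4τ : Real.log 4 ≤ Real.log (|s.im| + 4) :=
    Real.log_le_log (by norm_num) (by linarith [abs_nonneg s.im])
  have hlog4 : 0 < Real.log 4 := Real.log_pos (by norm_num)
  set ℒ := Real.log q + Real.log (|s.im| + 4) with hℒ
  set ℒ₀ := Real.log q + Real.log 4 with hℒ₀
  have hℒ1 : 1 ≤ ℒ := by linarith
  have hℒ0 : 0 < ℒ := by linarith
  have hℒ₀0 : 0 < ℒ₀ := by linarith
  have hℒ₀ℒ : ℒ₀ ≤ ℒ := by linarith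
  have h1 : c / ℒ ≤ c := div_le_self hc.le hℒ1
  have h2 : c / ℒ ≤ cζ / Real.log (|s.im| + 4) := by
    calc c / ℒ ≤ c / Real.log (|s.im| + 4) :=
          div_le_div_of_nonneg_left hc.le (by linarith) (by linarith)
      _ ≤ cζ / Real.log (|s.im| + 4) := div_le_div_of_nonneg_right hcζ (by linarith)
  have h3 : c / ℒ ≤ c₃ / ℒ := div_le_div_of_nonneg_right hc₃ hℒ0.le
  have h4 : c / ℒ ≤ c / ℒ₀ := div_le_div_of_nonneg_left hc.le hℒ₀0 hℒ₀ℒ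
  exact ⟨by linarith, by linarith, by linarith, by linarith⟩

/-- A point with `σ > 1 − c/ℒ₀` is at distance `≥ c_m/(2ℒ₀)` from every real `a' ≤ 1 − c_m/ℒ₀`
when `c ≤ c_m/2`. [folklore] -/
theorem dist_ge_of_re {s : ℂ} {a' cm c ℒ₀ : ℝ} (hℒ₀ : 0 < ℒ₀) (hc : c ≤ cm / 2)
    (hs : 1 - c / ℒ₀ < s.re) (ha : a' ≤ 1 - cm / ℒ₀) :
    cm / (2 * ℒ₀) ≤ ‖s - (a' : ℂ)‖ := by
  have hre : (s - (a' : ℂ)).re = s.re - a' := by simp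
  have h1 : s.re - a' ≤ ‖s - (a' : ℂ)‖ := by rw [← hre]; exact re_le_norm _
  have h2 : c / ℒ₀ ≤ cm / 2 / ℒ₀ := div_le_div_of_nonneg_right hc hℒ₀.le
  have h3 : cm / (2 * ℒ₀) = cm / ℒ₀ - cm / 2 / ℒ₀ := by field_simp; ring
  linarith

/-- `ℒ₀ = log q + log 4 ≥ 1`. [folklore] -/
theorem one_le_ell0 (q : ℕ) : 1 ≤ Real.log q + Real.log 4 := by
  have := one_le_ell q 0
  rwa [abs_zero, zero_add] at this

section Facts

variable {c₃ C₃ cP cL : ℝ}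

/-- **The non-exceptional characters on the region** (MV Theorem 11.16, proof: the other
`L(s, χ')` have no zero in the region): let `χ` mod `q` be quadratic non-principal with the real
zero `β > 1 − c/ℒ₀` (`ℒ₀ = log q + log 4`, `c ≤ min(c_P, c_L)/2`), and `χ' ≠ χ₀, χ`. Every real
zero `a' > 1 − 2c₃/ℒ₀` of `L(s, χ')` has `a' ≤ 1 − c_L/ℒ₀` (`χ'` is quadratic by MV Theorem 11.3,
then Landau, MV Theorem 11.7 at one modulus), so a point `s` of the region
(`σ > 1 − c/ℒ₀`, `σ ≥ 1 − c₃/(log q + log(|t|+4))`) is at distance `≥ d₀ = min(c_m/(2ℒ₀), 1)`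
from it; hence `L(s, χ') ≠ 0` and `‖L'/L(s, χ')‖ ≤ C₃ (ℒ₀³/d₀) log(|t|+4)` by MV Theorem 11.4.
[cite: MontgomeryVaughan2007, Theorem 11.16 (proof) and Corollary 11.8] -/
theorem nonexc_facts
    (hzf : ∀ (q : ℕ) [NeZero q] (χ : DirichletCharacter ℂ q), χ ≠ 1 → ∀ ρ : ℂ,
      χ.LFunction ρ = 0 → 1 - 2 * c₃ / (Real.log q + Real.log (|ρ.im| + 4)) < ρ.re →
        χ ^ 2 = 1 ∧ ρ.im = 0)
    (hL : ∀ (q : ℕ) [NeZero q] (χ : DirichletCharacter ℂ q), χ ≠ 1 →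
      ∀ (s : ℂ) (d : ℝ), 0 < d → d ≤ 1 →
        1 - c₃ / (Real.log q + Real.log (|s.im| + 4)) ≤ s.re →
        (∀ a : ℂ, χ.LFunction a = 0 → a.im = 0 →
          1 - 2 * c₃ / (Real.log q + Real.log 4) < a.re → d ≤ ‖s - a‖) →
        χ.LFunction s ≠ 0 ∧
          ‖deriv χ.LFunction s / χ.LFunction s‖ ≤
            C₃ * ((Real.log q + Real.log 4) ^ 3 / d) * Real.log (|s.im| + 4))
    (hLan : ∀ (q : ℕ) [NeZero q] (χ₁ χ₂ : DirichletCharacter ℂ q),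
      χ₁ ≠ 1 → χ₂ ≠ 1 → χ₁ ^ 2 = 1 → χ₂ ^ 2 = 1 → χ₁ ≠ χ₂ →
      ∀ β₁ β₂ : ℝ, χ₁.LFunction β₁ = 0 → χ₂.LFunction β₂ = 0 →
        min β₁ β₂ ≤ 1 - cL / (Real.log q + Real.log 4))
    (hcP : 0 < cP) (hcL : 0 < cL)
    {q : ℕ} [NeZero q] {χ χ' : DirichletCharacter ℂ q} (hχ1 : χ ≠ 1) (hχ2 : χ ^ 2 = 1)
    (hχ'1 : χ' ≠ 1) (hne : χ' ≠ χ) {β c : ℝ} (hβ : χ.LFunction β = 0)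
    (hc : c ≤ min cP cL / 2) (hβc : 1 - c / (Real.log q + Real.log 4) < β) {s : ℂ}
    (hs₃ : 1 - c₃ / (Real.log q + Real.log (|s.im| + 4)) ≤ s.re)
    (hs : 1 - c / (Real.log q + Real.log 4) < s.re) :
    χ'.LFunction s ≠ 0 ∧
      ‖deriv χ'.LFunction s / χ'.LFunction s‖ ≤
        C₃ * ((Real.log q + Real.log 4) ^ 3 /
          min (min cP cL / (2 * (Real.log q + Real.log 4))) 1) * Real.log (|s.im| + 4) := by
  set ℒ₀ := Real.log q + Real.log 4 with hℒ₀def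
  have hℒ₀ : 0 < ℒ₀ := one_pos.trans_le (one_le_ell0 q)
  set cm := min cP cL with hcm
  have hcm0 : 0 < cm := lt_min hcP hcL
  have hcmL : cm ≤ cL := min_le_right _ _
  have hd0 : 0 < min (cm / (2 * ℒ₀)) 1 := lt_min (by positivity) one_pos
  have hd1 : min (cm / (2 * ℒ₀)) 1 ≤ 1 := min_le_right _ _
  refine hL q χ' hχ'1 s _ hd0 hd1 hs₃ fun a hLa haim hare ↦ ?_
  -- `a` is a real zero `a' > 1 − 2c₃/ℒ₀` of `L(·, χ')`
  obtain ⟨a', rfl⟩ : ∃ a' : ℝ, a = a' := ⟨a.re, Complex.ext (by simp) (by simp [haim])⟩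
  simp only [Complex.ofReal_re] at hare
  -- `χ'` is quadratic
  have hχ'2 : χ' ^ 2 = 1 := by
    refine (hzf q χ' hχ'1 a' hLa ?_).1
    simpa only [Complex.ofReal_im, abs_zero, zero_add, Complex.ofReal_re] using hare
  -- Landau: `min β a' ≤ 1 − c_L/ℒ₀`, and `β > 1 − c_L/ℒ₀`
  have hmin := hLan q χ χ' hχ1 hχ'1 hχ2 hχ'2 (Ne.symm hne) β a' hβ hLa
  have hβL : 1 - cL / ℒ₀ < β := by
    have h1 : c / ℒ₀ ≤ cL / 2 / ℒ₀ := div_le_div_of_nonneg_right (hc.trans (by linarith)) hℒ₀.le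
    have h2 : cL / 2 / ℒ₀ < cL / ℒ₀ := div_lt_div_of_pos_right (by linarith) hℒ₀
    linarith
  have ha' : a' ≤ 1 - cL / ℒ₀ := by
    rcases min_le_iff.1 hmin with h | h
    · exact absurd h (not_le.2 hβL)
    · exact h
  have ha'' : a' ≤ 1 - cm / ℒ₀ := by
    have : cm / ℒ₀ ≤ cL / ℒ₀ := div_le_div_of_nonneg_right hcmL hℒ₀.le
    linarith
  calc min (cm / (2 * ℒ₀)) 1 ≤ cm / (2 * ℒ₀) := min_le_left _ _
    _ ≤ ‖s - (a' : ℂ)‖ := dist_ge_of_re hℒ₀ hc hs ha''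

/-- **The exceptional character on the region, off `β`** (MV Theorem 11.16, Case 2): with `χ`,
`β`, `c` as in `nonexc_facts`, every OTHER real zero `a' > 1 − 2c₃/ℒ₀` of `L(s, χ)` has
`a' ≤ 1 − c_P/ℒ₀` (MV Theorem 11.3, Case 4, `exists_min_realZeros_le`), so a point `s ≠ β` of the
region is at distance `≥ d = min(|s − β|, c_m/(2ℒ₀), 1)` from all of them: `L(s, χ) ≠ 0` and
`‖L'/L(s, χ)‖ ≤ C₃ (ℒ₀³/d) log(|t|+4)`.
[cite: MontgomeryVaughan2007, Theorem 11.16 (proof, Case 2)] -/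
theorem exc_facts
    (hL : ∀ (q : ℕ) [NeZero q] (χ : DirichletCharacter ℂ q), χ ≠ 1 →
      ∀ (s : ℂ) (d : ℝ), 0 < d → d ≤ 1 →
        1 - c₃ / (Real.log q + Real.log (|s.im| + 4)) ≤ s.re →
        (∀ a : ℂ, χ.LFunction a = 0 → a.im = 0 →
          1 - 2 * c₃ / (Real.log q + Real.log 4) < a.re → d ≤ ‖s - a‖) →
        χ.LFunction s ≠ 0 ∧
          ‖deriv χ.LFunction s / χ.LFunction s‖ ≤
            C₃ * ((Real.log q + Real.log 4) ^ 3 / d) * Real.log (|s.im| + 4))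
    (hP : ∀ (q : ℕ) [NeZero q] (χ : DirichletCharacter ℂ q), χ ≠ 1 → ∀ β₀ β₁ : ℝ,
      χ.LFunction β₀ = 0 → χ.LFunction β₁ = 0 → β₀ ≠ β₁ →
        min β₀ β₁ ≤ 1 - cP / (Real.log q + Real.log 4))
    (hcP : 0 < cP) (hcL : 0 < cL)
    {q : ℕ} [NeZero q] {χ : DirichletCharacter ℂ q} (hχ1 : χ ≠ 1) {β c : ℝ}
    (hβ : χ.LFunction β = 0) (hc : c ≤ min cP cL / 2)
    (hβc : 1 - c / (Real.log q + Real.log 4) < β) {s : ℂ} (hsβ : s ≠ (β : ℂ))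
    (hs₃ : 1 - c₃ / (Real.log q + Real.log (|s.im| + 4)) ≤ s.re)
    (hs : 1 - c / (Real.log q + Real.log 4) < s.re) :
    χ.LFunction s ≠ 0 ∧
      ‖deriv χ.LFunction s / χ.LFunction s‖ ≤
        C₃ * ((Real.log q + Real.log 4) ^ 3 /
          min (min ‖s - (β : ℂ)‖ (min cP cL / (2 * (Real.log q + Real.log 4)))) 1) *
          Real.log (|s.im| + 4) := by
  set ℒ₀ := Real.log q + Real.log 4 with hℒ₀def
  have hℒ₀ : 0 < ℒ₀ := one_pos.trans_le (one_le_ell0 q)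
  set cm := min cP cL with hcm
  have hcm0 : 0 < cm := lt_min hcP hcL
  have hcmP : cm ≤ cP := min_le_left _ _
  have hdist0 : 0 < ‖s - (β : ℂ)‖ := norm_pos_iff.2 (sub_ne_zero.2 hsβ)
  have hd0 : 0 < min (min ‖s - (β : ℂ)‖ (cm / (2 * ℒ₀))) 1 :=
    lt_min (lt_min hdist0 (by positivity)) one_pos
  have hd1 : min (min ‖s - (β : ℂ)‖ (cm / (2 * ℒ₀))) 1 ≤ 1 := min_le_right _ _
  refine hL q χ hχ1 s _ hd0 hd1 hs₃ fun a hLa haim hare ↦ ?_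
  obtain ⟨a', rfl⟩ : ∃ a' : ℝ, a = a' := ⟨a.re, Complex.ext (by simp) (by simp [haim])⟩
  rcases eq_or_ne a' β with rfl | hne
  · exact (min_le_left _ _).trans (min_le_left _ _)
  · have hmin := hP q χ hχ1 β a' hβ hLa (Ne.symm hne)
    have hβP : 1 - cP / ℒ₀ < β := by
      have h1 : c / ℒ₀ ≤ cP / 2 / ℒ₀ :=
        div_le_div_of_nonneg_right (hc.trans (by linarith)) hℒ₀.le
      have h2 : cP / 2 / ℒ₀ < cP / ℒ₀ := div_lt_div_of_pos_right (by linarith) hℒ₀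
      linarith
    have ha' : a' ≤ 1 - cP / ℒ₀ := by
      rcases min_le_iff.1 hmin with h | h
      · exact absurd h (not_le.2 hβP)
      · exact h
    have ha'' : a' ≤ 1 - cm / ℒ₀ := by
      have : cm / ℒ₀ ≤ cP / ℒ₀ := div_le_div_of_nonneg_right hcmP hℒ₀.le
      linarith
    calc min (min ‖s - (β : ℂ)‖ (cm / (2 * ℒ₀))) 1 ≤ cm / (2 * ℒ₀) :=
          (min_le_left _ _).trans (min_le_right _ _)
      _ ≤ ‖s - (a' : ℂ)‖ := dist_ge_of_re hℒ₀ hc hs ha''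

end Facts

/-! ## Arithmetic of the bound for `F` -/

/-- The three pieces of `F`: with `lt = log(|t|+4) ≥ 1`, `W = 2ℒ₀/c_m + 1`, `r = 1/|s − β| ≥ 0`,
`T₁ ≤ (C_ζ + 3L)·lt`, `T₂ ≤ q C₃ ℒ₀³ d₀⁻¹ lt` with `d₀⁻¹ ≤ W`, `T₃ ≤ C₃ ℒ₀³ d⁻¹ lt + r` with
`d⁻¹ ≤ r + W`: `T₁ + T₂ + T₃ ≤ P · lt⁵ · (1 + r)` for
`P = C_ζ + 3L + (q+1) C₃ ℒ₀³ W + C₃ ℒ₀³ + 1`. [folklore] -/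
theorem three_pieces_le {T₁ T₂ T₃ Cζ Lq q C₃ ℒ₀ W r lt dinv d₀inv : ℝ} (hCζ : 0 ≤ Cζ) (hL : 0 ≤ Lq)
    (hq : 0 ≤ q) (hC₃ : 0 ≤ C₃) (hℒ₀ : 0 ≤ ℒ₀) (hW : 0 ≤ W) (hr : 0 ≤ r) (hlt : 1 ≤ lt)
    (h1 : T₁ ≤ (Cζ + 3 * Lq) * lt) (h2 : T₂ ≤ q * (C₃ * (ℒ₀ ^ 3 * d₀inv) * lt))
    (hd₀ : d₀inv ≤ W)
    (h3 : T₃ ≤ C₃ * (ℒ₀ ^ 3 * dinv) * lt + r) (hd : dinv ≤ r + W) :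
    T₁ + T₂ + T₃ ≤ (Cζ + 3 * Lq + (q + 1) * (C₃ * ℒ₀ ^ 3 * W) + C₃ * ℒ₀ ^ 3 + 1) * lt ^ 5 * (1 + r) := by
  have hB : 0 ≤ C₃ * ℒ₀ ^ 3 := by positivity
  have hlt0 : 0 ≤ lt := by linarith
  have hlt5 : lt ≤ lt ^ 5 := by
    calc lt = lt ^ 1 := (pow_one lt).symm
      _ ≤ lt ^ 5 := pow_le_pow_right₀ hlt (by norm_num)
  -- T₂ ≤ q B W lt
  have h2' : T₂ ≤ q * (C₃ * ℒ₀ ^ 3) * W * lt := by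
    have : C₃ * (ℒ₀ ^ 3 * d₀inv) ≤ C₃ * ℒ₀ ^ 3 * W := by
      rw [← mul_assoc]; exact mul_le_mul_of_nonneg_left hd₀ hB
    have := mul_le_mul_of_nonneg_left (mul_le_mul_of_nonneg_right this hlt0) hq
    linarith
  -- T₃ ≤ B (r + W) lt + r
  have h3' : T₃ ≤ (C₃ * ℒ₀ ^ 3) * (r + W) * lt + r := by
    have : C₃ * (ℒ₀ ^ 3 * dinv) ≤ C₃ * ℒ₀ ^ 3 * (r + W) := by
      rw [← mul_assoc]; exact mul_le_mul_of_nonneg_left hd hB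
    have := mul_le_mul_of_nonneg_right this hlt0
    linarith
  -- collect
  set B := C₃ * ℒ₀ ^ 3 with hBdef
  have hsum : T₁ + T₂ + T₃ ≤ (Cζ + 3 * Lq + q * B * W + B * W) * lt + (B * lt + 1) * r := by
    nlinarith
  have hstep : (Cζ + 3 * Lq + q * B * W + B * W) * lt + (B * lt + 1) * r ≤
      (Cζ + 3 * Lq + (q + 1) * (B * W) + B + 1) * lt * (1 + r) := by
    have e1 : (B * lt + 1) * r ≤ (B + 1) * lt * r := by nlinarith
    have e2 : 0 ≤ (Cζ + 3 * Lq + q * B * W + B * W) * lt := by positivity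
    have e3 : 0 ≤ (B + 1) * lt := by positivity
    nlinarith
  have hfin : (Cζ + 3 * Lq + (q + 1) * (B * W) + B + 1) * lt * (1 + r) ≤
      (Cζ + 3 * Lq + (q + 1) * (B * W) + B + 1) * lt ^ 5 * (1 + r) := by
    have hP0 : 0 ≤ Cζ + 3 * Lq + (q + 1) * (B * W) + B + 1 := by positivity
    have h1r : 0 ≤ 1 + r := by linarith
    have := mul_le_mul_of_nonneg_left hlt5 hP0
    exact mul_le_mul_of_nonneg_right this h1r
  linarith

/-- The constant of the bound is `≪ q⁵`: with `Lq = log q ≤ q`, `ℒ₀ ≤ 4q`, `W ≤ (8/c_m + 1)q`,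
`q ≥ 1`: `P ≤ K q⁵`, `K = C_ζ + 4 + 128 C₃ (8/c_m + 1) + 64 C₃`. [folklore] -/
theorem P_le_K {Cζ Lq q C₃ ℒ₀ W cm : ℝ} (hCζ : 0 ≤ Cζ) (hC₃ : 0 ≤ C₃) (hcm : 0 < cm) (hq : 1 ≤ q)
    (hL : Lq ≤ q) (hℒ₀ : ℒ₀ ≤ 4 * q) (hℒ₀0 : 0 ≤ ℒ₀) (hW : W ≤ (8 / cm + 1) * q)
    (hW0 : 0 ≤ W) :
    Cζ + 3 * Lq + (q + 1) * (C₃ * ℒ₀ ^ 3 * W) + C₃ * ℒ₀ ^ 3 + 1 ≤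
      (Cζ + 4 + 128 * C₃ * (8 / cm + 1) + 64 * C₃) * q ^ 5 := by
  have hq0 : 0 ≤ q := by linarith
  have hq5 : 1 ≤ q ^ 5 := one_le_pow₀ hq
  have hℒ₀3 : ℒ₀ ^ 3 ≤ 64 * q ^ 3 := by
    calc ℒ₀ ^ 3 ≤ (4 * q) ^ 3 := pow_le_pow_left₀ hℒ₀0 hℒ₀ 3
      _ = 64 * q ^ 3 := by ring
  have hk : 0 ≤ 8 / cm + 1 := by positivity
  have e1 : (q + 1) * (C₃ * ℒ₀ ^ 3 * W) ≤ 128 * C₃ * (8 / cm + 1) * q ^ 5 := by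
    have hq1 : q + 1 ≤ 2 * q := by linarith
    calc (q + 1) * (C₃ * ℒ₀ ^ 3 * W) ≤ (2 * q) * (C₃ * (64 * q ^ 3) * ((8 / cm + 1) * q)) := by
          gcongr
      _ = 128 * C₃ * (8 / cm + 1) * q ^ 5 := by ring
  have e2 : C₃ * ℒ₀ ^ 3 ≤ 64 * C₃ * q ^ 5 := by
    calc C₃ * ℒ₀ ^ 3 ≤ C₃ * (64 * q ^ 3) := by gcongr
      _ = 64 * C₃ * q ^ 3 := by ring
      _ ≤ 64 * C₃ * q ^ 5 := by
          have : q ^ 3 ≤ q ^ 5 := pow_le_pow_right₀ hq (by norm_num)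
          have hC : 0 ≤ 64 * C₃ := by positivity
          nlinarith
  have e3 : 3 * Lq ≤ 3 * q ^ 5 := by
    have : q ≤ q ^ 5 := by
      calc q = q ^ 1 := (pow_one q).symm
        _ ≤ q ^ 5 := pow_le_pow_right₀ hq (by norm_num)
    linarith
  have e4 : Cζ ≤ Cζ * q ^ 5 := by nlinarith
  have e5 : (1 : ℝ) ≤ q ^ 5 := hq5
  nlinarith

/-! ## The hypotheses `ExcPsiData` for `Λ_{q,a}`, uniformly in `q` -/

/-- `‖A − B − C‖ ≤ ‖A‖ + ‖B‖ + ‖C‖`. [folklore] -/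
theorem norm_sub_sub_le (A B C : ℂ) : ‖A - B - C‖ ≤ ‖A‖ + ‖B‖ + ‖C‖ :=
  calc ‖A - B - C‖ ≤ ‖A - B‖ + ‖C‖ := norm_sub_le _ _
    _ ≤ ‖A‖ + ‖B‖ + ‖C‖ := by gcongr; exact norm_sub_le _ _

/-- The sum over the non-exceptional characters: if `‖L'/L(s, χ')‖ ≤ B` for all
`χ' ∈ S = {χ' ≠ χ₀} ∖ {χ}`, then `‖∑_{χ' ∈ S} χ'(a⁻¹) L'/L(s, χ')‖ ≤ q B`. [folklore] -/
theorem norm_sum_erase_le {q : ℕ} [NeZero q] {inst : DecidableEq (DirichletCharacter ℂ q)}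
    (χ : DirichletCharacter ℂ q) (a : ZMod q) {s : ℂ} {B : ℝ} (hB : 0 ≤ B)
    (hχ : ∀ χ' ∈ (({1}ᶜ : Finset (DirichletCharacter ℂ q)).erase χ),
      ‖deriv χ'.LFunction s / χ'.LFunction s‖ ≤ B) :
    ‖∑ χ' ∈ (({1}ᶜ : Finset (DirichletCharacter ℂ q)).erase χ),
        χ' a⁻¹ * (deriv χ'.LFunction s / χ'.LFunction s)‖ ≤ q * B := by
  set S := (({1}ᶜ : Finset (DirichletCharacter ℂ q)).erase χ) with hS
  calc ‖∑ χ' ∈ S, χ' a⁻¹ * (deriv χ'.LFunction s / χ'.LFunction s)‖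
      ≤ ∑ χ' ∈ S, ‖χ' a⁻¹ * (deriv χ'.LFunction s / χ'.LFunction s)‖ := norm_sum_le _ _
    _ ≤ ∑ χ' ∈ S, B := by
        refine Finset.sum_le_sum fun χ' hχ' ↦ ?_
        rw [norm_mul]
        calc ‖χ' a⁻¹‖ * ‖deriv χ'.LFunction s / χ'.LFunction s‖ ≤ 1 * B :=
              mul_le_mul (DirichletCharacter.norm_le_one χ' _) (hχ χ' hχ') (norm_nonneg _)
                zero_le_one
          _ = B := one_mul _
    _ = #S * B := by rw [Finset.sum_const, nsmul_eq_mul]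
    _ ≤ q * B := by
        refine mul_le_mul_of_nonneg_right ?_ hB
        calc (#S : ℝ) ≤ #({1}ᶜ : Finset (DirichletCharacter ℂ q)) := by
              exact_mod_cast Finset.card_erase_le
          _ ≤ q := SiegelWalfisz.card_compl_one_le q

/-- **MV Theorem 11.16, Case 2, as hypotheses for Landau's method** (with (11.22) and
Corollary 11.17): there are ABSOLUTE constants `0 < c ≤ 1/2` and `K ≥ 0` such that for every
`q ≥ 1`, every quadratic non-principal `χ` mod `q` with a real zero `β ∈ (1 − c/log 4q, 1)` of
`L(s, χ)`, and every reduced class `a` mod `q`, the sequence `Λ_{q,a} = φ(q)Λ𝟙_{≡ a}` and the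
function `F` = `excF q a χ β` satisfy
`Literature.NumberTheory.LFunctions.ExcPsiData Λ_{q,a} F c (Kq⁵) (log q) β χ(a)`:
`∑ Λ_{q,a}(n)n^{-s} = 1/(s−1) − χ(a)/(s−β) + F(s)`; `F` is holomorphic on
`σ > 1 − c/(log q + log(|t|+4))` (no zero of any `L(s,χ')` there besides the simple zero `β`
of `L(s,χ)`); and `|F(s)| ≤ Kq⁵ log⁵(|t|+4)(1 + 1/|s−β|)` off `β` (MV Theorem 11.4 for `χ' ≠ χ₀`,
Theorem 6.7 for `ζ`). `c = min(c₃, min(c_P,c_L)/2, c₄, c_ζ, 1/4)` from the tree's MV Theorems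
11.3–11.4, Corollary 11.8, the simplicity of `β`, and Theorem 6.6.
[cite: MontgomeryVaughan2007, Theorem 11.16 (proof, Case 2) and Corollary 11.17] -/
theorem exists_excPsiData :
    ∃ c : ℝ, 0 < c ∧ c ≤ 1 / 2 ∧ ∃ K : ℝ, 0 ≤ K ∧
      ∀ (q : ℕ) [NeZero q] (χ : DirichletCharacter ℂ q), χ ≠ 1 → χ.IsQuadratic →
        ∀ β : ℝ, 1 - c / Real.log (4 * q) < β → β < 1 → χ.LFunction β = 0 →
          ∀ a : ZMod q, IsUnit a →
            ExcPsiData (fun n ↦ (q.totient : ℝ) * ArithmeticFunction.vonMangoldt.residueClass a n)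
              (excF q a χ β) c (K * (q : ℝ) ^ 5) (Real.log q) β (χ a).re := by
  classical
  obtain ⟨c₃, hc₃, C₃, hC₃, hzf, hL⟩ := exists_norm_logDeriv_le_of_re_ge
  obtain ⟨cP, hcP, hP⟩ := exists_min_realZeros_le
  obtain ⟨cL, hcL, hLan⟩ := exists_landau_sameLevel_min_le
  obtain ⟨c₄, hc₄, hsimple⟩ := exists_deriv_ne_zero_of_realZero
  obtain ⟨cζ, hcζ, Cζ, hCζ, hζ⟩ :=
    Literature.NumberTheory.LFunctions.classicalZFRData_riemannZeta.norm_logDeriv_le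
  have hcm0 : 0 < min cP cL := lt_min hcP hcL
  set c : ℝ := min (min (min c₃ (min cP cL / 2)) (min c₄ cζ)) (1 / 4) with hcdef
  have hcc₃ : c ≤ c₃ := ((min_le_left _ _).trans (min_le_left _ _)).trans (min_le_left _ _)
  have hccm : c ≤ min cP cL / 2 :=
    ((min_le_left _ _).trans (min_le_left _ _)).trans (min_le_right _ _)
  have hcc₄ : c ≤ c₄ := ((min_le_left _ _).trans (min_le_right _ _)).trans (min_le_left _ _)
  have hccζ : c ≤ cζ := ((min_le_left _ _).trans (min_le_right _ _)).trans (min_le_right _ _)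
  have hc4 : c ≤ 1 / 4 := min_le_right _ _
  have hcpos : 0 < c :=
    lt_min (lt_min (lt_min hc₃ (by positivity)) (lt_min hc₄ hcζ)) (by norm_num)
  clear_value c
  set K : ℝ := Cζ + 4 + 128 * C₃ * (8 / min cP cL + 1) + 64 * C₃ with hK
  have hK0 : 0 ≤ K := by positivity
  refine ⟨c, hcpos, by linarith, K, hK0, fun q _ χ hχ1 hquad β hβc hβ1 hβ a ha ↦ ?_⟩
  -- setup at the modulus `q`
  have hq1 : (1 : ℝ) ≤ q := by exact_mod_cast NeZero.one_le
  have hq0 : (0 : ℝ) < q := by linarith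
  have hlogq : 0 ≤ Real.log q := Real.log_nonneg hq1
  set ℒ₀ := Real.log q + Real.log 4 with hℒ₀
  have hℒ₀1 : 1 ≤ ℒ₀ := one_le_ell0 q
  have hℒ₀0 : 0 < ℒ₀ := by linarith
  have hlog4q : Real.log (4 * q) = ℒ₀ := by
    rw [Real.log_mul (by norm_num) hq0.ne', hℒ₀, add_comm]
  rw [hlog4q] at hβc
  have hχ2 : χ ^ 2 = 1 := hquad.sq_eq_one
  obtain ⟨hαeq, hαle⟩ := quadratic_apply_inv_eq_re hquad ha
  have hβhalf : 1 / 2 ≤ β := by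
    have : c / ℒ₀ ≤ c := div_le_self hcpos.le hℒ₀1
    linarith
  -- the exceptional zero is simple: `g(β) ≠ 0`
  have hgβ : dslope χ.LFunction (β : ℂ) (β : ℂ) ≠ 0 := by
    rw [dslope_same]
    refine hsimple q χ hχ1 β hβ ?_
    have : c / ℒ₀ ≤ c₄ / ℒ₀ := div_le_div_of_nonneg_right hcc₄ hℒ₀0.le
    linarith
  have hgd := differentiable_dslope_LFunction χ hχ1 (β : ℂ)
  have hT := DirichletCharacter.differentiable_LFunctionTrivChar₁ q
  -- sizes of the constants at `q`
  set W : ℝ := 2 * ℒ₀ / min cP cL + 1 with hW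
  have hW0 : 0 ≤ W := by positivity
  have hd₀inv : (min (min cP cL / (2 * ℒ₀)) 1)⁻¹ ≤ W := by
    refine (inv_min_le (by positivity) one_pos).trans ?_
    rw [inv_div, inv_one]
  have hLq : Real.log q ≤ q := Real.log_le_self hq0.le
  have hℒ₀4 : ℒ₀ ≤ 4 * q := by
    have : Real.log 4 ≤ 3 := by
      have := Real.log_le_sub_one_of_pos (by norm_num : (0 : ℝ) < 4); linarith
    rw [hℒ₀]; linarith
  have hWq : W ≤ (8 / min cP cL + 1) * q := by
    rw [hW, add_mul, div_mul_eq_mul_div]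
    have h1 : 2 * ℒ₀ / min cP cL ≤ 8 * q / min cP cL :=
      div_le_div_of_nonneg_right (by linarith) hcm0.le
    linarith
  have hPK := P_le_K hCζ hC₃ hcm0 hq1 hLq hℒ₀4 hℒ₀0.le hWq hW0
  rw [← hK] at hPK
  -- analytic facts at a point of the region
  have hpt : ∀ s : ℂ, 1 - c / (Real.log q + Real.log (|s.im| + 4)) < s.re →
      DifferentiableAt ℂ (excF q a χ β) s ∧
        (s ≠ (β : ℂ) → ‖excF q a χ β s‖ ≤
          K * (q : ℝ) ^ 5 * Real.log (|s.im| + 4) ^ 5 * (1 + ‖s - (β : ℂ)‖⁻¹)) := by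
    intro s hs
    obtain ⟨h34, hsζ, hs₃, hs0⟩ := region_facts hcpos hcc₃ hccζ hc4 hs
    have hlt : 1 ≤ Real.log (|s.im| + 4) := ClassicalZFRData.one_le_log_tau s.im
    -- `ζ` and the principal character
    obtain ⟨hζne, hζb⟩ := hζ s (by linarith) hsζ
    obtain ⟨hL₁0, hL₁b⟩ := SiegelWalfisz.norm_logDeriv_LFunctionTrivChar₁_le q h34.le hζne
    -- the non-exceptional characters
    have hN : ∀ χ' ∈ (({1}ᶜ : Finset (DirichletCharacter ℂ q)).erase χ),
        χ'.LFunction s ≠ 0 ∧ ‖deriv χ'.LFunction s / χ'.LFunction s‖ ≤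
          C₃ * (ℒ₀ ^ 3 / min (min cP cL / (2 * ℒ₀)) 1) * Real.log (|s.im| + 4) := by
      intro χ' hχ'
      rw [Finset.mem_erase] at hχ'
      have hχ'1 : χ' ≠ 1 := by simpa using hχ'.2
      exact nonexc_facts hzf hL hLan hcP hcL hχ1 hχ2 hχ'1 hχ'.1 hβ hccm hβc hs₃ hs0
    -- the exceptional character: `g ≠ 0` at `s`
    have hgs : dslope χ.LFunction (β : ℂ) s ≠ 0 := by
      rcases eq_or_ne s (β : ℂ) with rfl | hsβ
      · exact hgβ
      · exact dslope_ne_zero_of_ne χ hβ (exc_facts hL hP hcP hcL hχ1 hβ hccm hβc hsβ hs₃ hs0).1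
    -- differentiability of `F`
    have hT' : DifferentiableAt ℂ (deriv (DirichletCharacter.LFunctionTrivChar₁ q)) s :=
      ((hT.analyticAt s).deriv).differentiableAt
    have hg' : DifferentiableAt ℂ (deriv (dslope χ.LFunction (β : ℂ))) s :=
      ((hgd.analyticAt s).deriv).differentiableAt
    have hdiff : DifferentiableAt ℂ (excF q a χ β) s := by
      unfold excF
      refine DifferentiableAt.fun_sub (DifferentiableAt.fun_sub ?_ ?_) ?_
      · exact (hT'.fun_div (hT s) hL₁0).fun_neg
      · refine DifferentiableAt.fun_sum fun χ' hχ' ↦ ?_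
        have hχ'1 : χ' ≠ 1 := by
          rw [Finset.mem_erase] at hχ'; simpa using hχ'.2
        have hLχ := DirichletCharacter.differentiable_LFunction hχ'1
        have hLχ' : DifferentiableAt ℂ (deriv χ'.LFunction) s :=
          ((hLχ.analyticAt s).deriv).differentiableAt
        exact (hLχ'.fun_div (hLχ s) (hN χ' hχ').1).const_mul _
      · exact (hg'.fun_div (hgd s) hgs).const_mul _
    refine ⟨hdiff, fun hsβ ↦ ?_⟩
    -- the bound, off `β`
    obtain ⟨hLχ0, hLχb⟩ := exc_facts hL hP hcP hcL hχ1 hβ hccm hβc hsβ hs₃ hs0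
    have hT1 : ‖-(deriv (DirichletCharacter.LFunctionTrivChar₁ q) s /
        DirichletCharacter.LFunctionTrivChar₁ q s)‖ ≤ (Cζ + 3 * Real.log q) * Real.log (|s.im| + 4) := by
      rw [norm_neg]
      refine (hL₁b.trans (add_le_add hζb le_rfl)).trans ?_
      rw [add_mul]
      have : 3 * Real.log q ≤ 3 * Real.log q * Real.log (|s.im| + 4) := by
        have h0 : 0 ≤ 3 * Real.log q := by positivity
        nlinarith
      linarith
    have hB0 : 0 ≤ C₃ * (ℒ₀ ^ 3 / min (min cP cL / (2 * ℒ₀)) 1) * Real.log (|s.im| + 4) := by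
      have : 0 < min (min cP cL / (2 * ℒ₀)) 1 := lt_min (by positivity) one_pos
      positivity
    have hT2 := norm_sum_erase_le χ a hB0 (fun χ' hχ' ↦ (hN χ' hχ').2)
    have hT3 : ‖χ a⁻¹ * (deriv (dslope χ.LFunction (β : ℂ)) s / dslope χ.LFunction (β : ℂ) s)‖ ≤
        C₃ * (ℒ₀ ^ 3 / min (min ‖s - (β : ℂ)‖ (min cP cL / (2 * ℒ₀))) 1) *
          Real.log (|s.im| + 4) + ‖s - (β : ℂ)‖⁻¹ := by
      rw [norm_mul]
      have h1 := norm_logDeriv_dslope_le χ hχ1 hβ hLχ0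
      calc ‖χ a⁻¹‖ * ‖deriv (dslope χ.LFunction (β : ℂ)) s / dslope χ.LFunction (β : ℂ) s‖
          ≤ 1 * (‖deriv χ.LFunction s / χ.LFunction s‖ + ‖s - (β : ℂ)‖⁻¹) :=
            mul_le_mul (DirichletCharacter.norm_le_one χ _) h1 (norm_nonneg _) zero_le_one
        _ ≤ _ := by rw [one_mul]; linarith
    -- distances
    have hdist0 : 0 < ‖s - (β : ℂ)‖ := norm_pos_iff.2 (sub_ne_zero.2 hsβ)
    have hdinv : (min (min ‖s - (β : ℂ)‖ (min cP cL / (2 * ℒ₀))) 1)⁻¹ ≤ ‖s - (β : ℂ)‖⁻¹ + W := by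
      refine (inv_min_le (lt_min hdist0 (by positivity)) one_pos).trans ?_
      have := inv_min_le hdist0 (by positivity : 0 < min cP cL / (2 * ℒ₀))
      rw [inv_div] at this
      rw [inv_one, hW]
      linarith
    have hthree := three_pieces_le (T₁ := ‖-(deriv (DirichletCharacter.LFunctionTrivChar₁ q) s /
        DirichletCharacter.LFunctionTrivChar₁ q s)‖)
      (T₂ := ‖∑ χ' ∈ (({1}ᶜ : Finset (DirichletCharacter ℂ q)).erase χ),
        χ' a⁻¹ * (deriv χ'.LFunction s / χ'.LFunction s)‖)
      (T₃ := ‖χ a⁻¹ * (deriv (dslope χ.LFunction (β : ℂ)) s / dslope χ.LFunction (β : ℂ) s)‖)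
      hCζ hlogq hq0.le hC₃ hℒ₀0.le hW0 (inv_nonneg.2 (norm_nonneg _)) hlt hT1
      (by rw [div_eq_mul_inv] at hT2; exact hT2) hd₀inv
      (by rw [div_eq_mul_inv] at hT3; exact hT3) hdinv
    have hnorm : ‖excF q a χ β s‖ ≤
        ‖-(deriv (DirichletCharacter.LFunctionTrivChar₁ q) s / DirichletCharacter.LFunctionTrivChar₁ q s)‖ +
        ‖∑ χ' ∈ (({1}ᶜ : Finset (DirichletCharacter ℂ q)).erase χ),
          χ' a⁻¹ * (deriv χ'.LFunction s / χ'.LFunction s)‖ +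
        ‖χ a⁻¹ * (deriv (dslope χ.LFunction (β : ℂ)) s / dslope χ.LFunction (β : ℂ) s)‖ := by
      unfold excF
      exact norm_sub_sub_le _ _ _
    refine (hnorm.trans hthree).trans ?_
    have h1r : 0 ≤ 1 + ‖s - (β : ℂ)‖⁻¹ := by positivity
    have hl5 : 0 ≤ Real.log (|s.im| + 4) ^ 5 := by positivity
    exact mul_le_mul_of_nonneg_right (mul_le_mul_of_nonneg_right hPK hl5) h1r
  -- the structure
  refine ⟨hcpos, by linarith, by positivity, hlogq, hβhalf, hβ1, hαle, fun n ↦ ?_, fun s hs ↦ ?_,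
    fun s hs ↦ ?_, fun s hs ↦ (hpt s hs).1.differentiableWithinAt, fun s hs hsβ ↦ (hpt s hs).2 hsβ⟩
  · exact mul_nonneg (Nat.cast_nonneg _) (ArithmeticFunction.vonMangoldt.residueClass_nonneg a n)
  · -- summability for `σ > 1`
    have h1 : LSeriesSummable (↗(ArithmeticFunction.vonMangoldt.residueClass a)) s :=
      LSeriesSummable_of_abscissaOfAbsConv_lt_re
        ((ArithmeticFunction.vonMangoldt.abscissaOfAbsConv_residueClass_le_one a).trans_lt
          (by exact_mod_cast hs))
    have h2 := h1.smul (q.totient : ℂ)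
    refine (LSeriesSummable_congr s fun {n} _ ↦ ?_).1 h2
    simp only [Pi.smul_apply, smul_eq_mul]
    push_cast
    ring
  · -- the identity (11.22)
    have := LSeries_residueClass_eq_excF hχ1 hβ ha hs
    rw [hαeq] at this
    exact this

end Literature.NumberTheory.LFunctions.PagePNT
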